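import Mathlib
import HarnessLib

/-!
# Route `LocalSineTubeDoor`, crux `LocalPointZoom` (stmt-NavierStokesRegularity-20017) —
# support file 4: the `L³ → uniform` upgrade under equi-Hölder bounds (generic measure theory)

Cell ns-regularity-ideate, seat p6 (route-directed support, `--supports stmt-NavierStokesRegularity-20017`);
port of the generic lemmas of the cell's interior vorticity upgrade (Sketch4/8A, `Cell.NsRegP1c`):

* `volume_ball_prod_eq`, `volume_ball_prod_pos` — the volume of a (sup-metric) ball of `ℝ × ℝ³` does not
  depend on the centre;
* `uniform_of_L3_of_holder` — LEVEL-ZERO UPGRADE: an (eventually) equi-Hölder sequence converging in `L³(Q)`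
  to a uniformly continuous function converges uniformly on every set whose `δ₀`-neighbourhood lies in the
  open set `Q` (Chebyshev on `δ`-balls of fixed volume; no Arzelà–Ascoli, no subsequence);
* `norm_fderiv_sub_le_iteratedFDeriv_one` — first derivatives differ at most by the difference of the `1`-jets.

No Navier–Stokes content.  WHAT THIS IS NOT: not a claim about Navier–Stokes regularity.
-/

noncomputable section

namespace Summit.NavierStokesRegularity.NavierStokesRegularity.Theorems.LocalSineTubeDoorLocalPointZoomUpgrade

open MeasureTheory Set Function Filter Topology Metric
open scoped NNReal ENNReal

/-- Volume of a (sup-metric) ball of `ℝ × ℝ³` does not depend on the centre. -/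
theorem volume_ball_prod_eq (w : ℝ × (EuclideanSpace ℝ (Fin 3))) (d : ℝ) :
    volume (ball w d) = ENNReal.ofReal (2 * d) * volume (ball (0 : (EuclideanSpace ℝ (Fin 3))) d) := by
  rw [← ball_prod_same, Measure.volume_eq_prod, Measure.prod_prod, Real.volume_ball,
    Measure.addHaar_ball_center volume w.2 d]

/-- A (sup-metric) ball of `ℝ × ℝ³` of positive radius has positive volume. -/
theorem volume_ball_prod_pos (w : ℝ × (EuclideanSpace ℝ (Fin 3))) {d : ℝ} (hd : 0 < d) : 0 < volume (ball w d) :=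
  isOpen_ball.measure_pos volume ⟨w, mem_ball_self hd⟩

/-- **Level-zero upgrade**: an (eventually) equi-Hölder sequence converging in `L³(Q)` to a
uniformly continuous function converges uniformly on every set whose `δ₀`-neighbourhood lies in
the open set `Q` (Chebyshev on `δ`-balls of fixed volume). -/
theorem uniform_of_L3_of_holder {F : ℕ → ℝ × (EuclideanSpace ℝ (Fin 3)) → (EuclideanSpace ℝ (Fin 3))} {f : ℝ × (EuclideanSpace ℝ (Fin 3)) → (EuclideanSpace ℝ (Fin 3))} {Q S : Set (ℝ × (EuclideanSpace ℝ (Fin 3)))}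
    (hQ : IsOpen Q) {Cₕ αₕ : ℝ≥0} (hα : 0 < αₕ)
    (hF : ∀ᶠ j in atTop, HolderOnWith Cₕ αₕ (F j) Q) (hf : UniformContinuousOn f Q)
    (hL : Tendsto (fun j => eLpNorm (fun z => F j z - f z) 3 (volume.restrict Q)) atTop (𝓝 0))
    {δ₀ : ℝ} (hδ₀ : 0 < δ₀) (hS : ∀ w ∈ S, ball w δ₀ ⊆ Q) :
    ∀ ε > 0, ∀ᶠ j in atTop, ∀ w ∈ S, ‖F j w - f w‖ < ε := by
  intro ε hε
  -- a Hölder radius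
  obtain ⟨d₁, hd₁, hd₁b⟩ : ∃ d₁ : ℝ, 0 < d₁ ∧ (Cₕ : ℝ) * d₁ ^ (αₕ : ℝ) ≤ ε / 4 := by
    refine ⟨(ε / (4 * (Cₕ + 1))) ^ ((αₕ : ℝ)⁻¹), by positivity, ?_⟩
    rw [Real.rpow_inv_rpow (by positivity) (by exact_mod_cast hα.ne')]
    have hC0 : (0 : ℝ) ≤ Cₕ := Cₕ.coe_nonneg
    calc (Cₕ : ℝ) * (ε / (4 * (Cₕ + 1))) = ε / 4 * (Cₕ / (Cₕ + 1)) := by field_simp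
      _ ≤ ε / 4 * 1 := by gcongr; exact (div_le_one (by positivity)).2 (by linarith)
      _ = ε / 4 := mul_one _
  -- a uniform-continuity radius
  obtain ⟨d₂, hd₂, hd₂b⟩ := Metric.uniformContinuousOn_iff.1 hf (ε / 4) (by positivity)
  set d : ℝ := min δ₀ (min d₁ d₂) with hd_def
  have hd : 0 < d := lt_min hδ₀ (lt_min hd₁ hd₂)
  have hdδ : d ≤ δ₀ := min_le_left _ _
  have hdd₁ : d ≤ d₁ := (min_le_right _ _).trans (min_le_left _ _)
  have hdd₂ : d ≤ d₂ := (min_le_right _ _).trans (min_le_right _ _)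
  -- the volume of a `d`-ball and the Chebyshev threshold
  set V : ℝ≥0∞ := ENNReal.ofReal (2 * d) * volume (ball (0 : (EuclideanSpace ℝ (Fin 3))) d) with hV
  have hVw : ∀ w : ℝ × (EuclideanSpace ℝ (Fin 3)), volume (ball w d) = V := fun w => volume_ball_prod_eq w d
  have hV0 : 0 < V := by rw [← hVw 0]; exact volume_ball_prod_pos 0 hd
  set c : ℝ≥0∞ := ENNReal.ofReal (ε / 2) with hc
  have hc0 : c ≠ 0 := by rw [hc]; exact (ENNReal.ofReal_pos.2 (by positivity)).ne'
  have h3 : (3 : ℝ≥0∞).toReal = 3 := by norm_num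
  have hpos : 0 < c ^ (3 : ℝ≥0∞).toReal * V := by
    rw [h3]
    exact ENNReal.mul_pos (ENNReal.rpow_pos (pos_iff_ne_zero.2 hc0) ENNReal.ofReal_ne_top).ne'
      hV0.ne'
  have hev : ∀ᶠ j in atTop,
      eLpNorm (fun z => F j z - f z) 3 (volume.restrict Q) ^ (3 : ℝ≥0∞).toReal <
        c ^ (3 : ℝ≥0∞).toReal * V := by
    have ht : Tendsto (fun j => eLpNorm (fun z => F j z - f z) 3 (volume.restrict Q) ^
        (3 : ℝ≥0∞).toReal) atTop (𝓝 0) := by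
      have h := ((ENNReal.continuous_rpow_const (y := (3 : ℝ≥0∞).toReal)).tendsto
        (0 : ℝ≥0∞)).comp hL
      rw [h3] at h ⊢
      rw [Function.comp_def, ENNReal.zero_rpow_of_pos (by norm_num : (0 : ℝ) < 3)] at h
      exact h
    exact (tendsto_order.1 ht).2 _ hpos
  filter_upwards [hev, hF] with j hj hFj w hw
  by_contra hbad
  rw [not_lt] at hbad
  -- on the `d`-ball around `w` the difference is at least `ε / 2`
  have hballQ : ball w d ⊆ Q := (ball_subset_ball hdδ).trans (hS w hw)
  have hwQ : w ∈ Q := hballQ (mem_ball_self hd)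
  have hlow : ball w d ⊆ {z | c ≤ ‖F j z - f z‖ₑ} := by
    intro z hz
    have hzQ : z ∈ Q := hballQ hz
    have hzw : dist z w < d := mem_ball.1 hz
    have e1 : ‖F j z - F j w‖ ≤ ε / 4 := by
      have h := hFj.dist_le_of_le hzQ hwQ hzw.le
      rw [dist_eq_norm] at h
      refine h.trans (le_trans ?_ hd₁b)
      exact mul_le_mul_of_nonneg_left (Real.rpow_le_rpow hd.le hdd₁ (by positivity))
        Cₕ.coe_nonneg
    have e2 : ‖f z - f w‖ < ε / 4 := by
      have h := hd₂b z hzQ w hwQ (hzw.trans_le hdd₂)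
      rwa [dist_eq_norm] at h
    have e3 : ε / 2 ≤ ‖F j z - f z‖ := by
      have : F j w - f w = (F j z - f z) - (F j z - F j w) + (f z - f w) := by abel
      have h4 : ‖F j w - f w‖ ≤ ‖F j z - f z‖ + ‖F j z - F j w‖ + ‖f z - f w‖ := by
        rw [this]
        exact (norm_add_le _ _).trans (add_le_add (norm_sub_le _ _) le_rfl)
      linarith
    show c ≤ ‖F j z - f z‖ₑ
    rw [hc, ← ofReal_norm]
    exact ENNReal.ofReal_le_ofReal e3
  -- Chebyshev
  have hmeas : AEStronglyMeasurable (fun z => F j z - f z) (volume.restrict Q) :=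
    (((hFj.uniformContinuousOn hα).continuousOn).sub hf.continuousOn).aestronglyMeasurable
      hQ.measurableSet
  have hcheb := mul_meas_ge_le_pow_eLpNorm' (volume.restrict Q) (p := 3) (by norm_num) (by norm_num)
    hmeas c
  have hVle : V ≤ (volume.restrict Q) {z | c ≤ ‖F j z - f z‖ₑ} := by
    rw [← hVw w, ← Measure.restrict_eq_self volume hballQ]
    exact measure_mono hlow
  have hge : c ^ (3 : ℝ≥0∞).toReal * V ≤
      eLpNorm (fun z => F j z - f z) 3 (volume.restrict Q) ^ (3 : ℝ≥0∞).toReal :=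
    (mul_le_mul_right hVle _).trans hcheb
  exact absurd (hge.trans_lt hj) (lt_irrefl _)

/-- The first derivatives differ at most by the difference of the `1`-jets. -/
theorem norm_fderiv_sub_le_iteratedFDeriv_one {E F : Type*} [NormedAddCommGroup E]
    [NormedSpace ℝ E] [NormedAddCommGroup F] [NormedSpace ℝ F] (f g : E → F) (x : E) :
    ‖fderiv ℝ f x - fderiv ℝ g x‖ ≤ ‖iteratedFDeriv ℝ 1 f x - iteratedFDeriv ℝ 1 g x‖ := by
  refine ContinuousLinearMap.opNorm_le_bound _ (norm_nonneg _) fun e => ?_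
  have h : (fderiv ℝ f x - fderiv ℝ g x) e =
      (iteratedFDeriv ℝ 1 f x - iteratedFDeriv ℝ 1 g x) (fun _ => e) := by
    simp [iteratedFDeriv_one_apply]
  rw [h]
  refine (ContinuousMultilinearMap.le_opNorm _ _).trans (le_of_eq ?_)
  simp

end Summit.NavierStokesRegularity.NavierStokesRegularity.Theorems.LocalSineTubeDoorLocalPointZoomUpgrade

end
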